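import Literature.NumberTheory.EllipticCurves.HeegnerPointsKolyvaginPrimaryAnnihilatorProofs
import Literature.NumberTheory.EllipticCurves.HeegnerPointsKolyvaginPrimaryAtPrimeProofs
import HarnessLib

/-!
# Kolyvagin's annihilator `p^{M₀} · Ш(E/K)[p^∞] = 0` at ONE odd prime `p` with `ρ̄_{E,p}` onto,
# from the mod-`p^M` leaves with reciprocity at two Kolyvagin primes

Sibling proof file (theorems only: no definition, no named fact, no `sorry`) of
`HeegnerPointsKolyvaginPrimaryAnnihilatorProofs` (the abstract descent with Kolyvagin's exponent
`M₀`: `HypothesesM.pow_M₀_zsmul_mem_zmultiples`, under the two-place duality hypothesis `hdual₂`) and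
of `HeegnerPointsKolyvaginPrimaryLeavesProofs` / `…AtPrimeProofs` / `…ExponentProofs` (the leaves at
one prime; exponent `2m` there).

W. G. McCallum, *Kolyvagin's work on Shafarevich–Tate groups*, LMS Lecture Note Ser. 153 (1991),
§1 Theorem (Kolyvagin): *"… then `ord_p |Ш(E/K)| ≤ 2 ord_p [E(K) : ℤ y_K]`"* (ORDER form, NOT
obtained here), Lemma 5.1 (*"`M₀ = ord_p [E(K) : ℤ y_K]`"*), §2 Prop. 2.2 (the reciprocity law
`Σ_v ⟨s_v, c_v⟩ = 0` over ALL places), §5 Lemma 5.3; V. A. Kolyvagin, Proc. ICM Kyoto 1990, §2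
(*"`C' S'_M = 0` … `C`"*, `C = p^{M₀}`: the EXPONENT form with Kolyvagin's own exponent).  What is
proved here, at ONE odd prime `p` with `ρ̄_{E,p}` onto and for every `m` with `p^{m+1} ∤ y_K` in
`E(K)`:

* `hdual₂_of_kolyvaginReciprocityFinset`, `hdual_of_kolyvaginReciprocityFinset` — the two-place
  (resp. one-place) duality in ORDER form (McCallum Lemma 5.3 with Prop. 2.2 over `{λ, λ'}`, resp.
  `{λ}`) from the reciprocity law in PAIRING form against Selmer classes vanishing on a finite set of
  places (`T = {λ'}`, resp. `T = ∅`), through the tree's `lemma_5_3_descent_of_reciprocity`;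
* `exists_hypothesesM₂_of_leavesM` — the tree's `exists_hypothesesM_of_leavesM` (same construction,
  VERBATIM) returning in addition the abstract two-place duality of the produced data from its
  concrete form `hdual₂`;
* `pow_smul_sha_primary_eq_zero_at_of_leavesM₂` — **`p^m · Ш(E/K)[p^∞] = 0`** from the `p`-slice of
  the leaves (A) + (B) + (B₂) (exponent `m`, not `2m`);
* `pow_smul_sha_primary_eq_zero_at_of_pointsM_of_reciprocityFinset` — the same from Heegner-type
  points (leaf (A′), binder `hpoints` of `…_at_of_pointsM_of_reciprocityM` VERBATIM) and Kolyvagin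
  reciprocity in pairing form against Selmer classes vanishing on finite sets of places (`hRT`; at
  `T = ∅` it is the tree's (R)_M).

## References

* [McCallumLMS1991] W. G. McCallum, *op. cit.*, §1 Theorem, §2 Prop. 2.2, §4 (6), Lemma 4.3,
  Prop. 4.4, §5 Lemma 5.1, Lemma 5.3, proof of Prop. 5.2 (held, PDF pp. 276–287).
* [GrossLMS1991] B. H. Gross, *Kolyvagin's work on modular elliptic curves*, LMS LN 153 (1991),
  Thm. 1.3 (2), Props. 5.3, 5.4 (2), §10 (held, PDF pp. 213–231).
* [Kolyvagin1990] V. A. Kolyvagin, Proc. ICM Kyoto 1990, vol. I, 429–436, §2 (read: galaxy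
  panama:376007206895683); *Euler systems* (1990), Thm. A (cite only; acq-00132).
-/

noncomputable section

open scoped Classical
open WeierstrassCurve NumberField IsDedekindDomain
open Literature.NumberTheory.GaloisRepresentations

universe u

namespace Literature.NumberTheory.EllipticCurves

namespace KolyvaginDescent

variable {N : ℕ} [NeZero N] (W : WeierstrassCurve ℚ) {K : Type u} [Field K] [NumberField K]

/-! ## Two-place and one-place duality in order form from reciprocity in pairing form -/

/-- **Leaf (B₂): two-place duality in order form from Kolyvagin reciprocity against Selmer classes
vanishing at one further place.** For `E/ℚ` elliptic, `K` imaginary quadratic with conjugation `c`,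
a Heegner point `P ∈ E(K)` of level `N` (good reduction at Kolyvagin primes), `p` odd, `M ≥ 1`: if
at every Kolyvagin prime `ℓ` of level `M` a biadditive alternating left-non-degenerate pairing `e`
on `E_{p^M}` has `e([s, F], [d, σ]) = 0` for all `s ∈ S_{p^M}(E/K)` vanishing at the places of a
finite set `T` and all `d` Selmer off `T ∪ {λ}` and at infinity (`𝔔 ∣ λ`, `F` a Frobenius at `𝔔`
fixing `E_{p^M}`, `σ ∈ I_𝔔`), then for Kolyvagin primes `ℓ ≠ ℓ'`, a `ν`-eigenclass `d` Selmer off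
`{λ, λ'}`, and `s ∈ S_{p^M}(E/K)^ν` with `s_{λ'} = 0`: `ord d_λ > p^a ⟹ p^{M-1-a} s_λ = 0`
(McCallum 1991, Lemma 5.3 with Prop. 2.2 over the places `λ, λ'`; tree
`lemma_5_3_descent_of_reciprocity` with `T = {λ'}`).
[cite: McCallumLMS1991, §5 Lemma 5.3, §2 Prop. 2.2, proof of Prop. 5.2] -/
theorem hdual₂_of_kolyvaginReciprocityFinset [W.IsElliptic]
    (hK : IsImaginaryQuadratic K) {P : (W.baseChange K).toAffine.Point}
    (hP : IsHeegnerPoint N W K P) {p : ℕ} (hp : p.Prime) (hp2 : p ≠ 2) {M : ℕ} (hM : 1 ≤ M)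
    {c : K ≃ₐ[ℚ] K} (hc : c ≠ 1)
    (hRT : ∀ {ℓ : ℕ} (hℓ : IsKolyvaginPrime N W K p ℓ), FrobEqFrobInfty W K (p ^ M) ℓ →
      ∃ (A : Type u) (_ : AddCommGroup A)
        (e : geomTorsion (W.baseChange K) ((p ^ M : ℕ) : ℤ) →+
          geomTorsion (W.baseChange K) ((p ^ M : ℕ) : ℤ) →+ A),
        (∀ x, e x x = 0) ∧ (∀ x, (∀ y, e x y = 0) → x = 0) ∧
        ∀ (T : Finset (HeightOneSpectrum (𝓞 K))),
        ∀ s ∈ selmerGroup (W.baseChange K) ((p ^ M : ℕ) : ℤ),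
          (∀ v ∈ T, s ∈ (W.baseChange K).torsionLocalKer (v.adicCompletion K) ((p ^ M : ℕ) : ℤ)) →
          ∀ c' : galH1Torsion (W.baseChange K) ((p ^ M : ℕ) : ℤ),
          (∀ v : HeightOneSpectrum (𝓞 K), v ∉ T → (ℓ : 𝓞 K) ∉ v.asIdeal →
            c' ∈ selmerLocalKer (W.baseChange K) (v.adicCompletion K) ((p ^ M : ℕ) : ℤ)) →
          (∀ w : InfinitePlace K,
            c' ∈ selmerLocalKer (W.baseChange K) w.Completion ((p ^ M : ℕ) : ℤ)) →
          ∀ 𝔔 ∈ hℓ.place.primesAbove, ∀ F : Field.absoluteGaloisGroup K,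
            IsArithFrobAt (𝓞 K) F 𝔔 →
            F ∈ torsionFixing (W.baseChange K) ((p ^ M : ℕ) : ℤ) →
            ∀ σ ∈ 𝔔.inertia (Field.absoluteGaloisGroup K),
            e (h1Eval (W.baseChange K) ((p ^ M : ℕ) : ℤ) s F)
              (h1Eval (W.baseChange K) ((p ^ M : ℕ) : ℤ) c' σ) = 0) :
    ∀ ℓ ℓ' : ℕ, IsKolyvaginPrime N W K p ℓ ∧ FrobEqFrobInfty W K (p ^ M) ℓ →
      IsKolyvaginPrime N W K p ℓ' ∧ FrobEqFrobInfty W K (p ^ M) ℓ' → ℓ ≠ ℓ' →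
      ∀ ν : ℤ, (ν = 1 ∨ ν = -1) → ∀ d : galH1Torsion (W.baseChange K) ((p ^ M : ℕ) : ℤ),
      conjAct W c _ d = ν • d →
      (∀ v : HeightOneSpectrum (𝓞 K), (ℓ : 𝓞 K) ∉ v.asIdeal → (ℓ' : 𝓞 K) ∉ v.asIdeal →
        d ∈ selmerLocalKer (W.baseChange K) (v.adicCompletion K) ((p ^ M : ℕ) : ℤ)) →
      (∀ w : InfinitePlace K,
        d ∈ selmerLocalKer (W.baseChange K) w.Completion ((p ^ M : ℕ) : ℤ)) →
      ∀ s ∈ selmerGroup (W.baseChange K) ((p ^ M : ℕ) : ℤ), conjAct W c _ s = ν • s →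
      (∀ v : HeightOneSpectrum (𝓞 K), (ℓ' : 𝓞 K) ∈ v.asIdeal →
        s ∈ (W.baseChange K).torsionLocalKer (v.adicCompletion K) ((p ^ M : ℕ) : ℤ)) →
      ∀ a : ℕ, a < M → ∀ v : HeightOneSpectrum (𝓞 K), (ℓ : 𝓞 K) ∈ v.asIdeal →
        ((p : ℤ) ^ a) • d ∉
          selmerLocalKer (W.baseChange K) (v.adicCompletion K) ((p ^ M : ℕ) : ℤ) →
        ((p : ℤ) ^ (M - 1 - a)) • s ∈
          (W.baseChange K).torsionLocalKer (v.adicCompletion K) ((p ^ M : ℕ) : ℤ) := by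
  intro ℓ ℓ' hℓ hℓ' _ ν hν d hd hfin hinf s hs hτs hsℓ' a _ v hv hdv
  have hvw : v = hℓ.1.place := hℓ.1.mem_iff.mp hv
  subst hvw
  have hgood : (W.baseChange K).HasGoodReductionAt hℓ.1.place := by
    have h := IsKolyvaginPrime.not_mem_badPlaces (W := W) hP hℓ.1
    rwa [WeierstrassCurve.mem_badPlaces_iff, not_not] at h
  obtain ⟨A, _, e, halt, hnd, hRe⟩ := hRT hℓ.1 hℓ.2
  refine lemma_5_3_descent_of_reciprocity W hK hp hp2 hc hℓ.1 hM rfl hℓ.2 hgood e halt hnd hν hd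
    hdv hs hτs (fun 𝔔 h𝔔 F hF hFT σ hσ ↦ hRe {hℓ'.1.place} s hs ?_ d ?_ hinf 𝔔 h𝔔 F hF hFT σ hσ)
  · intro v' hv'
    rw [Finset.mem_singleton] at hv'
    subst hv'
    exact hsℓ' _ hℓ'.1.mem_place
  · intro v' hv'T hv'ℓ
    refine hfin v' hv'ℓ (fun h ↦ hv'T ?_)
    rw [Finset.mem_singleton, hℓ'.1.mem_iff.mp h]

/-- **Leaf (B) in order form from the same pairing-form reciprocity (`T = ∅`)**: the hypothesis
`hdual` of `exists_hypothesesM_of_leavesM` verbatim (tree `hdual_of_kolyvaginReciprocityM`).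
[cite: McCallumLMS1991, §5 Lemma 5.3, §2 Prop. 2.2] -/
theorem hdual_of_kolyvaginReciprocityFinset [W.IsElliptic]
    (hK : IsImaginaryQuadratic K) {P : (W.baseChange K).toAffine.Point}
    (hP : IsHeegnerPoint N W K P) {p : ℕ} (hp : p.Prime) (hp2 : p ≠ 2) {M : ℕ} (hM : 1 ≤ M)
    {c : K ≃ₐ[ℚ] K} (hc : c ≠ 1)
    (hRT : ∀ {ℓ : ℕ} (hℓ : IsKolyvaginPrime N W K p ℓ), FrobEqFrobInfty W K (p ^ M) ℓ →
      ∃ (A : Type u) (_ : AddCommGroup A)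
        (e : geomTorsion (W.baseChange K) ((p ^ M : ℕ) : ℤ) →+
          geomTorsion (W.baseChange K) ((p ^ M : ℕ) : ℤ) →+ A),
        (∀ x, e x x = 0) ∧ (∀ x, (∀ y, e x y = 0) → x = 0) ∧
        ∀ (T : Finset (HeightOneSpectrum (𝓞 K))),
        ∀ s ∈ selmerGroup (W.baseChange K) ((p ^ M : ℕ) : ℤ),
          (∀ v ∈ T, s ∈ (W.baseChange K).torsionLocalKer (v.adicCompletion K) ((p ^ M : ℕ) : ℤ)) →
          ∀ c' : galH1Torsion (W.baseChange K) ((p ^ M : ℕ) : ℤ),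
          (∀ v : HeightOneSpectrum (𝓞 K), v ∉ T → (ℓ : 𝓞 K) ∉ v.asIdeal →
            c' ∈ selmerLocalKer (W.baseChange K) (v.adicCompletion K) ((p ^ M : ℕ) : ℤ)) →
          (∀ w : InfinitePlace K,
            c' ∈ selmerLocalKer (W.baseChange K) w.Completion ((p ^ M : ℕ) : ℤ)) →
          ∀ 𝔔 ∈ hℓ.place.primesAbove, ∀ F : Field.absoluteGaloisGroup K,
            IsArithFrobAt (𝓞 K) F 𝔔 →
            F ∈ torsionFixing (W.baseChange K) ((p ^ M : ℕ) : ℤ) →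
            ∀ σ ∈ 𝔔.inertia (Field.absoluteGaloisGroup K),
            e (h1Eval (W.baseChange K) ((p ^ M : ℕ) : ℤ) s F)
              (h1Eval (W.baseChange K) ((p ^ M : ℕ) : ℤ) c' σ) = 0) :
    ∀ ℓ : ℕ, IsKolyvaginPrime N W K p ℓ ∧ FrobEqFrobInfty W K (p ^ M) ℓ →
      ∀ ν : ℤ, (ν = 1 ∨ ν = -1) → ∀ d : galH1Torsion (W.baseChange K) ((p ^ M : ℕ) : ℤ),
      conjAct W c _ d = ν • d →
      (∀ v : HeightOneSpectrum (𝓞 K), (ℓ : 𝓞 K) ∉ v.asIdeal →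
        d ∈ selmerLocalKer (W.baseChange K) (v.adicCompletion K) ((p ^ M : ℕ) : ℤ)) →
      (∀ w : InfinitePlace K,
        d ∈ selmerLocalKer (W.baseChange K) w.Completion ((p ^ M : ℕ) : ℤ)) →
      ∀ s ∈ selmerGroup (W.baseChange K) ((p ^ M : ℕ) : ℤ), conjAct W c _ s = ν • s →
      ∀ a : ℕ, a < M → ∀ v : HeightOneSpectrum (𝓞 K), (ℓ : 𝓞 K) ∈ v.asIdeal →
        ((p : ℤ) ^ a) • d ∉
          selmerLocalKer (W.baseChange K) (v.adicCompletion K) ((p ^ M : ℕ) : ℤ) →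
        ((p : ℤ) ^ (M - 1 - a)) • s ∈
          (W.baseChange K).torsionLocalKer (v.adicCompletion K) ((p ^ M : ℕ) : ℤ) :=
  hdual_of_kolyvaginReciprocityM W hK hP hp hp2 hM hc fun hℓ hℓM ↦ by
    obtain ⟨A, _, e, halt, hnd, hRe⟩ := hRT hℓ hℓM
    exact ⟨A, inferInstance, e, halt, hnd, fun s hs c' hfin hinf ↦
      hRe ∅ s hs (fun _ h ↦ absurd h (Finset.notMem_empty _)) c' (fun v _ hv ↦ hfin v hv) hinf⟩

/-! ## The data `HypothesesM` with two-place duality, from the leaves (A) + (B) + (B₂) -/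

/-- **The tree's `exists_hypothesesM_of_leavesM`, returning in addition the abstract two-place
duality of the produced data** (same construction, field for field: `Sel = S_{p^M}(E/K)`,
`x = δ_M x₀`, `Kol ℓ` = Kolyvagin prime of level `M`, `pl ℓ` = its place, `Loc` = the Selmer local
kernels, `A ℓ` = the local vanishing condition at the places above `ℓ`, `τ = c_*`, `c = cl`).  The
extra hypothesis `hdual₂` is leaf (B₂) in concrete order form (as produced by
`hdual₂_of_kolyvaginReciprocityFinset`); the extra conclusion is the hypothesis `hdual₂` of
`HypothesesM.pow_M₀_zsmul_mem_zmultiples` for the produced `S`.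
[cite: McCallumLMS1991, §4 (6), Lemma 4.3, Prop. 4.4; §5 Lemma 5.1, Lemma 5.3; §2 Prop. 2.2]
[cite: GrossLMS1991, Props. 5.3, 5.4 (2)] -/
theorem exists_hypothesesM₂_of_leavesM [W.IsElliptic] (hK : IsImaginaryQuadratic K)
    {P : (W.baseChange K).toAffine.Point} {p : ℕ} (hp : p.Prime) (hp2 : p ≠ 2)
    (hρ : W.HasSurjectiveModNGaloisRep p) (hC : Automorphic.chebotarev_artinRep)
    (hW : W.exists_weilPairing p) {M : ℕ} (hM : 1 ≤ M)
    (hdiv : ∀ Q : geomPoints (W.baseChange K), ∃ R, ((p ^ M : ℕ) : ℤ) • R = Q)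
    {c : K ≃ₐ[ℚ] K} (hc : c ≠ 1) (hcc : c * c = 1)
    {M₀ : ℕ} {x₀ : (W.baseChange K).toAffine.Point} (hx₀ : p ^ M₀ • x₀ = P)
    (hPx : kummerMapTorsion (W.baseChange K) _ hdiv P =
      ((p : ℤ) ^ M₀) • kummerMapTorsion (W.baseChange K) _ hdiv x₀)
    (hxord : ((p : ℤ) ^ (M - 1)) • kummerMapTorsion (W.baseChange K) _ hdiv x₀ ≠ 0)
    (ε : ℤ) (hε : ε = 1 ∨ ε = -1)
    (h53 : IsOfFinAddOrder (Affine.Point.map (W' := W) (c : K →ₐ[ℚ] K) P - ε • P))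
    (cl : ℕ → galH1Torsion (W.baseChange K) ((p ^ M : ℕ) : ℤ))
    (hc1 : cl 1 = kummerMapTorsion (W.baseChange K) _ hdiv P)
    (hcl : ∀ m : ℕ, Squarefree m →
      (∀ q ∈ m.primeFactors, IsKolyvaginPrime N W K p q ∧ FrobEqFrobInfty W K (p ^ M) q) →
      conjAct W c _ (cl m) = (ε * (-1) ^ m.primeFactors.card) • cl m ∧
      (∀ v : HeightOneSpectrum (𝓞 K), (m : 𝓞 K) ∉ v.asIdeal →
        cl m ∈ selmerLocalKer (W.baseChange K) (v.adicCompletion K) ((p ^ M : ℕ) : ℤ)) ∧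
      (∀ ℓ : ℕ, ℓ.Prime → ℓ ∣ m → ∀ v : HeightOneSpectrum (𝓞 K), (ℓ : 𝓞 K) ∈ v.asIdeal →
        ∀ a : ℕ, (((p : ℤ) ^ a) • cl m ∈
            selmerLocalKer (W.baseChange K) (v.adicCompletion K) ((p ^ M : ℕ) : ℤ) ↔
          ((p : ℤ) ^ a) • cl (m / ℓ) ∈
            (W.baseChange K).torsionLocalKer (v.adicCompletion K) ((p ^ M : ℕ) : ℤ))))
    (hdual : ∀ ℓ : ℕ, IsKolyvaginPrime N W K p ℓ ∧ FrobEqFrobInfty W K (p ^ M) ℓ →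
      ∀ ν : ℤ, (ν = 1 ∨ ν = -1) → ∀ d : galH1Torsion (W.baseChange K) ((p ^ M : ℕ) : ℤ),
      conjAct W c _ d = ν • d →
      (∀ v : HeightOneSpectrum (𝓞 K), (ℓ : 𝓞 K) ∉ v.asIdeal →
        d ∈ selmerLocalKer (W.baseChange K) (v.adicCompletion K) ((p ^ M : ℕ) : ℤ)) →
      (∀ w : InfinitePlace K, d ∈ selmerLocalKer (W.baseChange K) w.Completion ((p ^ M : ℕ) : ℤ)) →
      ∀ s ∈ selmerGroup (W.baseChange K) ((p ^ M : ℕ) : ℤ), conjAct W c _ s = ν • s →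
      ∀ a : ℕ, a < M → ∀ v : HeightOneSpectrum (𝓞 K), (ℓ : 𝓞 K) ∈ v.asIdeal →
        ((p : ℤ) ^ a) • d ∉ selmerLocalKer (W.baseChange K) (v.adicCompletion K) ((p ^ M : ℕ) : ℤ) →
        ((p : ℤ) ^ (M - 1 - a)) • s ∈
          (W.baseChange K).torsionLocalKer (v.adicCompletion K) ((p ^ M : ℕ) : ℤ))
    (hdual₂ : ∀ ℓ ℓ' : ℕ, IsKolyvaginPrime N W K p ℓ ∧ FrobEqFrobInfty W K (p ^ M) ℓ →
      IsKolyvaginPrime N W K p ℓ' ∧ FrobEqFrobInfty W K (p ^ M) ℓ' → ℓ ≠ ℓ' →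
      ∀ ν : ℤ, (ν = 1 ∨ ν = -1) → ∀ d : galH1Torsion (W.baseChange K) ((p ^ M : ℕ) : ℤ),
      conjAct W c _ d = ν • d →
      (∀ v : HeightOneSpectrum (𝓞 K), (ℓ : 𝓞 K) ∉ v.asIdeal → (ℓ' : 𝓞 K) ∉ v.asIdeal →
        d ∈ selmerLocalKer (W.baseChange K) (v.adicCompletion K) ((p ^ M : ℕ) : ℤ)) →
      (∀ w : InfinitePlace K, d ∈ selmerLocalKer (W.baseChange K) w.Completion ((p ^ M : ℕ) : ℤ)) →
      ∀ s ∈ selmerGroup (W.baseChange K) ((p ^ M : ℕ) : ℤ), conjAct W c _ s = ν • s →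
      (∀ v : HeightOneSpectrum (𝓞 K), (ℓ' : 𝓞 K) ∈ v.asIdeal →
        s ∈ (W.baseChange K).torsionLocalKer (v.adicCompletion K) ((p ^ M : ℕ) : ℤ)) →
      ∀ a : ℕ, a < M → ∀ v : HeightOneSpectrum (𝓞 K), (ℓ : 𝓞 K) ∈ v.asIdeal →
        ((p : ℤ) ^ a) • d ∉ selmerLocalKer (W.baseChange K) (v.adicCompletion K) ((p ^ M : ℕ) : ℤ) →
        ((p : ℤ) ^ (M - 1 - a)) • s ∈
          (W.baseChange K).torsionLocalKer (v.adicCompletion K) ((p ^ M : ℕ) : ℤ)) :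
    ∃ S : HypothesesM (galH1Torsion (W.baseChange K) ((p ^ M : ℕ) : ℤ))
        (HeightOneSpectrum (𝓞 K) ⊕ InfinitePlace K),
      S.Sel = selmerGroup (W.baseChange K) ((p ^ M : ℕ) : ℤ) ∧
      S.x = kummerMapTorsion (W.baseChange K) _ hdiv x₀ ∧ S.p = p ∧ S.M₀ = M₀ ∧ S.M = M ∧
      (∀ ℓ ℓ', S.Kol ℓ → S.Kol ℓ' → ℓ ≠ ℓ' → ∀ ν : ℤ, (ν = 1 ∨ ν = -1) → ∀ d, S.τ d = ν • d →
        (∀ v, v ≠ S.pl ℓ → v ≠ S.pl ℓ' → d ∈ S.Loc v) → ∀ s ∈ S.Sel, S.τ s = ν • s → s ∈ S.A ℓ' →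
        ∀ a, a < S.M → ((S.p : ℤ) ^ a) • d ∉ S.Loc (S.pl ℓ) →
          ((S.p : ℤ) ^ (S.M - 1 - a)) • s ∈ S.A ℓ) := by
  have hn0 : ((p ^ M : ℕ) : ℤ) ≠ 0 := by exact_mod_cast pow_ne_zero M hp.ne_zero
  -- `E(K)[p] = 0`
  have hbot := torsionBy_eq_bot_of_isImaginaryQuadratic W K hK hp hp2 hρ
  have hA : ∀ a : (W.baseChange K).toAffine.Point, p • a = 0 → a = 0 := fun a ha ↦ by
    have : a ∈ AddSubgroup.torsionBy (W.baseChange K).toAffine.Point (p : ℤ) := by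
      rw [mem_torsionBy_iff, natCast_zsmul]; exact ha
    rw [hbot] at this
    exact this
  -- `τ x = ε x`
  set x := kummerMapTorsion (W.baseChange K) _ hdiv x₀ with hxdef
  have hεε : ε * ε = 1 := by rcases hε with rfl | rfl <;> norm_num
  have hτx : conjAct W c _ x = ε • x := by
    rw [hxdef, conjAct_kummerMapTorsion W c _ hdiv x₀]
    -- `t = c x₀ - ε x₀` is torsion
    set t := Affine.Point.map (W' := W) (c : K →ₐ[ℚ] K) x₀ - ε • x₀ with ht
    have htP : p ^ M₀ • t = Affine.Point.map (W' := W) (c : K →ₐ[ℚ] K) P - ε • P := by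
      rw [ht, smul_sub, ← map_nsmul, hx₀, smul_comm, hx₀]
    have htors : IsOfFinAddOrder t := by
      obtain ⟨k, hk, hkt⟩ := (isOfFinAddOrder_iff_nsmul_eq_zero).mp h53
      refine (isOfFinAddOrder_iff_nsmul_eq_zero).mpr ⟨k * p ^ M₀, Nat.mul_pos hk (pow_pos hp.pos _), ?_⟩
      rw [mul_smul, htP, hkt]
    obtain ⟨s, hs⟩ := exists_pow_smul_eq_of_isOfFinAddOrder hp hA htors M
    have hker : t ∈ (kummerMapTorsion (W.baseChange K) ((p ^ M : ℕ) : ℤ) hdiv).ker := by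
      rw [kummerMapTorsion_ker]
      exact ⟨s, by rw [← hs, Nat.cast_pow]; rfl⟩
    have ht0 : kummerMapTorsion (W.baseChange K) _ hdiv t = 0 := hker
    have : Affine.Point.map (W' := W) (c : K →ₐ[ℚ] K) x₀ = t + ε • x₀ := by rw [ht]; abel
    rw [this, map_add, ht0, zero_add, map_zsmul]
  -- the local conditions at the (complex) infinite places are empty
  have hinf : ∀ (w : InfinitePlace K) (y : galH1Torsion (W.baseChange K) ((p ^ M : ℕ) : ℤ)),
      y ∈ selmerLocalKer (W.baseChange K) w.Completion ((p ^ M : ℕ) : ℤ) := fun w y ↦ by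
    haveI : IsAlgClosed w.Completion :=
      isAlgClosed_of_ringEquiv (InfinitePlace.Completion.ringEquivComplexOfIsComplex
        (hK.2.isComplex w)).symm
    rw [WeierstrassCurve.selmerLocalKer_eq_top_of_isAlgClosed]
    trivial
  -- the structure (VERBATIM the tree's `exists_hypothesesM_of_leavesM`)
  refine ⟨
    { p := p
      hp := hp
      hp2 := hp2
      M := M
      torsion := fun v ↦ by
        have := zsmul_discreteH1_torsion ((p ^ M : ℕ) : ℤ) v
        exact_mod_cast this
      τ := conjAct W c _
      τ_τ := conjAct_conjAct_of_mul_self W hcc _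
      Sel := selmerGroup (W.baseChange K) _
      τ_mem := fun s hs ↦ conjAct_mem_selmerGroup W hK.2.isComplex c _ hs
      Loc := Sum.elim (fun v ↦ selmerLocalKer (W.baseChange K) (v.adicCompletion K) _)
        (fun w ↦ selmerLocalKer (W.baseChange K) w.Completion _)
      mem_sel_iff := fun s ↦ by rw [mem_selmerGroup_iff, Sum.forall]; rfl
      Kol := fun ℓ ↦ IsKolyvaginPrime N W K p ℓ ∧ FrobEqFrobInfty W K (p ^ M) ℓ
      prime_of_kol := fun ℓ h ↦ h.1.prime
      pl := fun ℓ ↦ if h : IsKolyvaginPrime N W K p ℓ ∧ FrobEqFrobInfty W K (p ^ M) ℓ then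
          Sum.inl h.1.place else Sum.inr (Classical.arbitrary _)
      Dv := fun v n ↦ Sum.elim (fun v ↦ (n : 𝓞 K) ∈ v.asIdeal) (fun _ ↦ False) v
      dv_iff := fun ℓ hℓ v ↦ by
        rw [dif_pos hℓ]
        rcases v with v | w
        · simp only [Sum.elim_inl, Sum.inl.injEq]
          exact hℓ.1.mem_iff
        · simp
      dv_mul := fun ℓ ℓ' _ _ v ↦ by
        rcases v with v | w
        · exact natCast_mul_mem_asIdeal
        · simp
      A := fun ℓ ↦ ⨅ (v : HeightOneSpectrum (𝓞 K)) (_ : (ℓ : 𝓞 K) ∈ v.asIdeal),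
        (W.baseChange K).torsionLocalKer (v.adicCompletion K) _
      x := x
      x_mem := (mem_selmerGroup_iff _ _ _).mpr
        ⟨fun _ ↦ kummerMapTorsion_mem_selmerLocalKer _ _ _ _ x₀,
          fun _ ↦ kummerMapTorsion_mem_selmerLocalKer _ _ _ _ x₀⟩
      x_ord := hxord
      M₀ := M₀
      ε := ε
      hε := hε
      τ_x := hτx
      c := cl
      c_one := by rw [hc1, hPx]
      τ_c := fun n hn ↦ (hcl n hn.1 hn.2).1
      c_mem_loc := fun n hn v hv ↦ by
        rcases v with v | w
        · exact (hcl n hn.1 hn.2).2.1 v hv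
        · exact hinf w (cl n)
      c_mem_loc_iff := fun ℓ m hℓ hn a ↦ by
        rw [dif_pos hℓ]
        simp only [Sum.elim_inl, AddSubgroup.mem_iInf]
        have key := (hcl (ℓ * m) hn.1 hn.2).2.2 ℓ hℓ.1.prime (dvd_mul_right ℓ m) hℓ.1.place
          hℓ.1.mem_place a
        rw [Nat.mul_div_cancel_left m hℓ.1.prime.pos] at key
        rw [key]
        constructor
        · intro h v hv
          rwa [hℓ.1.mem_iff.mp hv]
        · intro h
          exact h hℓ.1.place hℓ.1.mem_place
      duality := fun ℓ hℓ ν hν d hd hoff s hs hτs a ha hat ↦ by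
        rw [dif_pos hℓ] at hoff hat
        simp only [AddSubgroup.mem_iInf]
        intro v hv
        refine hdual ℓ hℓ ν hν d hd (fun v' hv' ↦ ?_) (fun w ↦ ?_) s hs hτs a ha v hv ?_
        · exact hoff (Sum.inl v') (fun h ↦ hv' (hℓ.1.mem_iff.mpr (Sum.inl_injective h)))
        · exact hoff (Sum.inr w) (by simp)
        · rwa [hℓ.1.mem_iff.mp hv]
      cebotarev := fun r cs Nv h0 hN hτ hind b ↦ by
        obtain ⟨ℓ, hlt, hKol, hfrob, hloc⟩ := McCallum1991_cor_3_2_pow_of_chebotarev (N := N) hC hK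
          hp hp2 hρ hW hM hc cs h0 Nv hN hτ hind b
        refine ⟨ℓ, hlt, ⟨hKol, hfrob⟩, fun i ↦ ⟨?_, fun hNi h ↦ ?_⟩⟩
        · simp only [AddSubgroup.mem_iInf]
          intro v hv
          exact (hloc i v hv).1
        · simp only [AddSubgroup.mem_iInf] at h
          exact (hloc i hKol.place hKol.mem_place).2 hNi (h hKol.place hKol.mem_place) },
    rfl, rfl, rfl, rfl, rfl, ?_⟩
  -- the two-place duality of the produced data, from `hdual₂`
  intro ℓ ℓ' hℓ hℓ' hne ν hν d hd hoff s hs hτs hsA a ha hat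
  change IsKolyvaginPrime N W K p ℓ ∧ FrobEqFrobInfty W K (p ^ M) ℓ at hℓ
  change IsKolyvaginPrime N W K p ℓ' ∧ FrobEqFrobInfty W K (p ^ M) ℓ' at hℓ'
  dsimp only at hoff hsA hat ⊢
  rw [dif_pos hℓ] at hoff hat
  rw [dif_pos hℓ'] at hoff
  simp only [AddSubgroup.mem_iInf] at hsA ⊢
  intro v hv
  refine hdual₂ ℓ ℓ' hℓ hℓ' hne ν hν d hd (fun v' hv' hv'' ↦ ?_) (fun w ↦ ?_) s hs hτs
    (fun v' hv' ↦ hsA v' hv') a ha v hv ?_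
  · exact hoff (Sum.inl v') (fun h ↦ hv' (hℓ.1.mem_iff.mpr (Sum.inl_injective h)))
      (fun h ↦ hv'' (hℓ'.1.mem_iff.mpr (Sum.inl_injective h)))
  · exact hoff (Sum.inr w) (by simp) (by simp)
  · rwa [hℓ.1.mem_iff.mp hv]

end KolyvaginDescent

end Literature.NumberTheory.EllipticCurves

end
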